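import Literature.NumberTheory.Sieve.LargeSieveCharacters
import Literature.NumberTheory.LFunctions.KMVFirstMomentBeyondDiagonal
import HarnessLib

/-!
# Route `PrimeLevelFamEdge`, crux K_B (stmt-Parity-20343), line `diagonal_kernel_split` rev 4, plan Ω,
# node **L7c, part 2 — separation of the level `q` from the MOLLIFIER (coefficients and range)**
# (OMEGA-BLUEPRINT v4 §3c; companion of `OffDiagLevelSeparation`)

In the level block `Σ_{q ∈ goodPrimes Δ′ N} offDiagCore Hf Δ′ q` the mollifier length `M(q) = q̂^{Δ′}`
moves with `q`: both the coefficients `c_l(q) = mollifierCoeff X² M(q) l` and the RANGE `l, m ≤ ⌊M(q)⌋₊`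
depend on the level. Before the large sieve (E18, `sum_totient_inv_largeConductor_le`) can see ONE
`q`-sequence for all outer parameters `(l, m, …)`, this dependence must be separated. Two exact devices:

* **coefficients** — at the profile `P = X²` the coefficient is an exact trinomial in `u = (log M)⁻¹` with
  `l`-only coefficients: `mollifierCoeff X² M l = μ(l)ψ(l)⁻¹ l^{−1/2}·(1 − 2(log l)·u + (log l)²·u²)`
  (`mollifierCoeff_X_sq_eq_trinomial`); `u(q) = (Δ′ log q̂)⁻¹` is then a smooth, slowly varying function of
  the level (Taylor device of `OffDiagLevelSeparation` if needed) and `|μ(l)ψ(l)⁻¹| ≤ 1`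
  (`abs_moebius_mul_psi_inv_le_one`);
* **range** — `Σ_{l,m ≤ ⌊M(q)⌋₊} = Σ_{l,m ≤ L} [max(l,m) ≤ ⌊M(q)⌋₊]` for any `L ≥ ⌊M(q)⌋₊`
  (`sum_sum_Icc_eq_sum_sum_ite_max`), and the monotone sharp cutoff has the EXACT finite Fourier expansion
  of the tree's Vaughan-Lemma-2 device (`LargeSieve.ite_le_eq_sum_e_mul_sepCoeff`):
  `[Z ≤ w] = 1 − Σ_{k<P} e(kw/P)·sepCoeff P (Z−1) k` (`ite_le_eq_one_sub_sum_sepCoeff`), whose coefficients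
  have the `Z`-FREE majorant `sepWeight P k` with `Σ_k sepWeight P k ≤ 2 + log P`
  (`sum_norm_sepCoeff_le`). With `w = ⌊M(q)⌋₊` the twist `e(k⌊M(q)⌋₊/P)` is a unimodular sequence in `q`
  ALONE, so E18 applies term by term at the ℓ¹-cost `(3 + log P)²`;
* **`sum_sum_sum_Icc_eq_separated`** — the block identity: for any finite `G`, any `Mf : ℕ → ℕ` with
  `Mf q ≤ L < P` on `G` and any summand `g`,
  `Σ_{q∈G} Σ_{l,m ≤ Mf q} g q l m = Σ_{l,m ≤ L} (Σ_{q∈G} g q l m − Σ_{k<P} sepCoeff P (max l m − 1) k · Σ_{q∈G} e(k·Mf q/P) g q l m)`,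
  with `norm_sepCoeff_max_le` for the majorant.

Finite sums only; exact identities plus the two majorants. Helper; closes nothing; standard axioms.
«The programme SEARCHES and TYPES; no claim about Landau–Siegel zeros, Theorems 1–2 of
arXiv:2211.02515 or a repaired Margin232 until a kernel theorem says so.»
-/

noncomputable section

open Finset Real Polynomial

namespace Summit.Parity.GeneralizedHardyLittlewood.Theorems.BeyondDiagonalBeatsQuarter.LevelSeparation

open Literature.NumberTheory.LFunctions.KMV2000 (mollifierCoeff psi one_le_psi)
open Literature.NumberTheory.Sieve.LargeSieve (e norm_e sepCoeff sepWeight ite_le_eq_sum_e_mul_sepCoeff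
  norm_sepCoeff_le sum_sepWeight_le sepWeight_nonneg)

/-! ### The coefficients: an exact trinomial in `(log M)⁻¹` -/

/-- **`P = X²` separates for free**: for `M > 0` with `log M ≠ 0` and `l ≥ 1`,
`mollifierCoeff X² M l = μ(l)·ψ(l)⁻¹·l^{−1/2}·(1 − 2 (log l)(log M)⁻¹ + (log l)² ((log M)⁻¹)²)`.
[cite: KowalskiMichelVanderKam2000, (8)–(9) p. 7 — derivation] -/
theorem mollifierCoeff_X_sq_eq_trinomial {M : ℝ} (hM : 0 < M) (hlogM : Real.log M ≠ 0) {l : ℕ}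
    (hl : l ≠ 0) :
    mollifierCoeff (X ^ 2) M l =
      (ArithmeticFunction.moebius l : ℝ) * ((psi l)⁻¹ * (l : ℝ) ^ (-(1 / 2 : ℝ))) *
        (1 - 2 * Real.log l * (Real.log M)⁻¹ + Real.log l ^ 2 * (Real.log M)⁻¹ ^ 2) := by
  have hl0 : (l : ℝ) ≠ 0 := by exact_mod_cast hl
  simp only [mollifierCoeff, eval_pow, eval_X]
  rw [Real.log_div hM.ne' hl0]
  field_simp
  ring

/-- `|μ(l)·ψ(l)⁻¹| ≤ 1` (`|μ| ≤ 1`, `ψ ≥ 1`). [cite: KowalskiMichelVanderKam2000, (8) p. 7 — derivation] -/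
theorem abs_moebius_mul_psi_inv_le_one (l : ℕ) :
    |(ArithmeticFunction.moebius l : ℝ) * (psi l)⁻¹| ≤ 1 := by
  have hψ : 1 ≤ psi l := one_le_psi l
  have hψ0 : 0 < psi l := by linarith
  rw [abs_mul, abs_inv, abs_of_pos hψ0]
  have hμ : |(ArithmeticFunction.moebius l : ℝ)| ≤ 1 := by
    have h := ArithmeticFunction.abs_moebius_le_one (n := l)
    exact_mod_cast h
  calc |(ArithmeticFunction.moebius l : ℝ)| * (psi l)⁻¹ ≤ 1 * 1 :=
        mul_le_mul hμ (inv_le_one_of_one_le₀ hψ) (inv_nonneg.2 hψ0.le) zero_le_one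
    _ = 1 := one_mul _

/-! ### The range: uniformisation and the exact finite Fourier expansion of the cutoff -/

/-- Range uniformisation: `Σ_{l ≤ K} f l = Σ_{l ≤ L} [l ≤ K] f l` for `K ≤ L`. [folklore] -/
theorem sum_Icc_eq_sum_Icc_ite {β : Type*} [AddCommMonoid β] (f : ℕ → β) {K L : ℕ} (hKL : K ≤ L) :
    ∑ l ∈ Icc 1 K, f l = ∑ l ∈ Icc 1 L, if l ≤ K then f l else 0 := by
  rw [← Finset.sum_filter]
  congr 1
  ext l
  simp only [mem_Icc, mem_filter]
  omega

/-- Double range uniformisation with the joint cutoff `max(l,m) ≤ K`: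
`Σ_{l,m ≤ K} g l m = Σ_{l,m ≤ L} [max(l,m) ≤ K] g l m` for `K ≤ L`. [folklore] -/
theorem sum_sum_Icc_eq_sum_sum_ite_max {β : Type*} [AddCommMonoid β] (g : ℕ → ℕ → β) {K L : ℕ}
    (hKL : K ≤ L) :
    ∑ l ∈ Icc 1 K, ∑ m ∈ Icc 1 K, g l m =
      ∑ l ∈ Icc 1 L, ∑ m ∈ Icc 1 L, if max l m ≤ K then g l m else 0 := by
  rw [sum_Icc_eq_sum_Icc_ite (fun l => ∑ m ∈ Icc 1 K, g l m) hKL]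
  refine Finset.sum_congr rfl fun l _ => ?_
  by_cases hl : l ≤ K
  · rw [if_pos hl, sum_Icc_eq_sum_Icc_ite (g l) hKL]
    refine Finset.sum_congr rfl fun m _ => ?_
    by_cases hm : m ≤ K
    · rw [if_pos hm, if_pos (max_le hl hm)]
    · rw [if_neg hm, if_neg (fun h => hm (le_trans (le_max_right l m) h))]
  · rw [if_neg hl]
    symm
    refine Finset.sum_eq_zero fun m _ => ?_
    rw [if_neg (fun h => hl (le_trans (le_max_left l m) h))]

/-- **Final-segment form of the finite Fourier expansion**: for `w < P` and `1 ≤ Z ≤ P`,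
`[Z ≤ w] = 1 − Σ_{k<P} e(kw/P)·sepCoeff P (Z−1) k` (complement of the tree's initial-segment expansion
`LargeSieve.ite_le_eq_sum_e_mul_sepCoeff`). [cite: Vaughan1980, Lemma 2 — derivation] -/
theorem ite_le_eq_one_sub_sum_sepCoeff {P w Z : ℕ} (hw : w < P) (hZ1 : 1 ≤ Z) (hZ : Z ≤ P) :
    (if Z ≤ w then (1 : ℂ) else 0) =
      1 - ∑ k ∈ range P, e ((k : ℝ) * w / P) * sepCoeff P (Z - 1) k := by
  rw [← ite_le_eq_sum_e_mul_sepCoeff hw (by omega)]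
  by_cases h : Z ≤ w
  · rw [if_pos h, if_neg (by omega), sub_zero]
  · rw [if_neg h, if_pos (by omega), sub_self]

/-- The ℓ¹-majorant of the cutoff coefficients: `Σ_{k<P} |sepCoeff P Z′ k| ≤ 2 + log P` for `Z′ < P`.
[cite: Vaughan1980, Lemma 2 — derivation] -/
theorem sum_norm_sepCoeff_le {P Z' : ℕ} (hZ : Z' < P) :
    ∑ k ∈ range P, ‖sepCoeff P Z' k‖ ≤ 2 + Real.log P :=
  (Finset.sum_le_sum fun k hk => norm_sepCoeff_le (mem_range.1 hk) hZ).trans (sum_sepWeight_le (by omega))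

/-- The `Z`-free majorant for the coefficients used below: for `1 ≤ l, m ≤ L < P` and `k < P`,
`|sepCoeff P (max l m − 1) k| ≤ sepWeight P k`. [cite: Vaughan1980, Lemma 2 — derivation] -/
theorem norm_sepCoeff_max_le {P L l m k : ℕ} (hl : l ∈ Icc 1 L) (hm : m ∈ Icc 1 L) (hLP : L < P)
    (hk : k < P) : ‖sepCoeff P (max l m - 1) k‖ ≤ sepWeight P k := by
  refine norm_sepCoeff_le hk ?_
  have h1 := (mem_Icc.1 hl).2
  have h2 := (mem_Icc.1 hm).2
  have : max l m ≤ L := max_le h1 h2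
  omega

/-- The twists are unimodular: `|e(k·w/P)| = 1`. [folklore] -/
theorem norm_e_twist (k w P : ℕ) : ‖e ((k : ℝ) * w / P)‖ = 1 := norm_e _

/-! ### The block identity: level sum outside ↦ inside, with the range cutoff separated -/

/-- **Separation of the mollifier range across a level block.** For a finite set of levels `G`, a range
function `Mf` (e.g. `q ↦ ⌊q̂^{Δ′}⌋₊`) with `Mf q ≤ L < P` on `G`, and any summand `g`:
`Σ_{q∈G} Σ_{l,m ∈ [1, Mf q]} g q l m
   = Σ_{l,m ∈ [1,L]} ( Σ_{q∈G} g q l m − Σ_{k<P} sepCoeff P (max l m − 1) k · Σ_{q∈G} e(k·Mf q/P)·g q l m )`.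
For each `k` the level sum carries only the unimodular `q`-sequence `e(k·Mf q/P)` (`norm_e_twist`); the
coefficients have the majorant `sepWeight P k`, `Σ_k ≤ 2 + log P` (`norm_sepCoeff_max_le`,
`LargeSieve.sum_sepWeight_le`). [cite: Vaughan1980, Lemma 2 — derivation] -/
theorem sum_sum_sum_Icc_eq_separated (G : Finset ℕ) (Mf : ℕ → ℕ) (g : ℕ → ℕ → ℕ → ℂ) {L P : ℕ}
    (hL : ∀ q ∈ G, Mf q ≤ L) (hLP : L < P) :
    ∑ q ∈ G, ∑ l ∈ Icc 1 (Mf q), ∑ m ∈ Icc 1 (Mf q), g q l m =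
      ∑ l ∈ Icc 1 L, ∑ m ∈ Icc 1 L,
        (∑ q ∈ G, g q l m -
          ∑ k ∈ range P, sepCoeff P (max l m - 1) k * ∑ q ∈ G, e ((k : ℝ) * Mf q / P) * g q l m) := by
  -- uniformise the range level by level
  have h1 : ∑ q ∈ G, ∑ l ∈ Icc 1 (Mf q), ∑ m ∈ Icc 1 (Mf q), g q l m =
      ∑ q ∈ G, ∑ l ∈ Icc 1 L, ∑ m ∈ Icc 1 L, if max l m ≤ Mf q then g q l m else 0 :=
    Finset.sum_congr rfl fun q hq => sum_sum_Icc_eq_sum_sum_ite_max (g q) (hL q hq)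
  rw [h1, Finset.sum_comm]
  refine Finset.sum_congr rfl fun l hl => ?_
  rw [Finset.sum_comm]
  refine Finset.sum_congr rfl fun m hm => ?_
  -- expand the cutoff for each level
  have hZ1 : 1 ≤ max l m := le_trans (mem_Icc.1 hl).1 (le_max_left l m)
  have hZ : max l m ≤ P := (max_le (mem_Icc.1 hl).2 (mem_Icc.1 hm).2).trans hLP.le
  have h2 : ∀ q ∈ G, (if max l m ≤ Mf q then g q l m else 0) =
      (1 - ∑ k ∈ range P, e ((k : ℝ) * Mf q / P) * sepCoeff P (max l m - 1) k) * g q l m := by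
    intro q hq
    rw [← ite_le_eq_one_sub_sum_sepCoeff (lt_of_le_of_lt (hL q hq) hLP) hZ1 hZ]
    split_ifs <;> simp
  rw [Finset.sum_congr rfl h2]
  simp only [sub_mul, one_mul, Finset.sum_sub_distrib, Finset.sum_mul, Finset.mul_sum]
  congr 1
  rw [Finset.sum_comm]
  exact Finset.sum_congr rfl fun k _ => Finset.sum_congr rfl fun q _ => by ring

/-- **The separated range term is controlled at ℓ¹-cost `2 + log P`**: for `1 ≤ l, m ≤ L < P` and any
level sums `V k` with `‖V k‖ ≤ B`,
`‖Σ_{k<P} sepCoeff P (max l m − 1) k · V k‖ ≤ (2 + log P)·B`. [cite: Vaughan1980, Lemma 2 — derivation] -/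
theorem norm_sum_sepCoeff_mul_le {P L l m : ℕ} (hl : l ∈ Icc 1 L) (hm : m ∈ Icc 1 L) (hLP : L < P)
    (V : ℕ → ℂ) {B : ℝ} (hV : ∀ k ∈ range P, ‖V k‖ ≤ B) :
    ‖∑ k ∈ range P, sepCoeff P (max l m - 1) k * V k‖ ≤ (2 + Real.log P) * B := by
  have hB : ∀ k ∈ range P, ‖sepCoeff P (max l m - 1) k * V k‖ ≤ sepWeight P k * B := by
    intro k hk
    rw [norm_mul]
    exact mul_le_mul (norm_sepCoeff_max_le hl hm hLP (mem_range.1 hk)) (hV k hk) (norm_nonneg _)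
      (sepWeight_nonneg P k)
  calc ‖∑ k ∈ range P, sepCoeff P (max l m - 1) k * V k‖
      ≤ ∑ k ∈ range P, sepWeight P k * B := (norm_sum_le _ _).trans (Finset.sum_le_sum hB)
    _ = (∑ k ∈ range P, sepWeight P k) * B := by rw [Finset.sum_mul]
    _ ≤ (2 + Real.log P) * B := by
        have hP : 0 < P := by omega
        have hB0 : 0 ≤ B := (norm_nonneg _).trans (hV 0 (mem_range.2 hP))
        exact mul_le_mul_of_nonneg_right (sum_sepWeight_le hP) hB0

end Summit.Parity.GeneralizedHardyLittlewood.Theorems.BeyondDiagonalBeatsQuarter.LevelSeparation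

end
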